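import Literature.Computability.Cryptography.ShorFactoring
import Mathlib.Analysis.SpecialFunctions.Pow.NthRootLemmas
import HarnessLib

/-!
# Integer roots digit by digit and the perfect-power base `ppBase` (pure layer for its program)

`ShorFactoring.lean` handles prime powers classically through `Shor1997.ppBase m`, the least
`b` with `b ^ k = m` for some `k ≥ 1` (defined by `Nat.find`, not by an algorithm). This file
gives the algorithmic form used by the program for `shorComp_isPolyTime`, over Mathlib's integer
root `Nat.nthRoot k m = ⌊m^{1/k}⌋` (`Mathlib/Data/Nat/NthRoot`, Newton's iteration = Cohen's
Algorithm 1.7.1; API `Nat.pow_nthRoot_le`, `Nat.lt_pow_nthRoot_add_one`, `Nat.le_nthRoot_iff`,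
`Nat.nthRoot_lt_iff`, `Nat.nthRoot_pow`, `Nat.exists_pow_eq_iff'`):

* `nthRoot_anti` (the root is antitone in the exponent), `nthRoot_lt_two_pow_size`
  (`size m` bits suffice);
* `rootScan m k J` — the root computed **digit by digit** (for `j = J, …, 0` set bit `j` if
  the `k`-th power still fits; the method a stack program implements with powering and
  comparison only), `rootScan_eq_nthRoot` for `Nat.nthRoot k m < 2 ^ (J + 1)`;
* `ppExp m` — the largest exponent `k ≤ size m` with `(Nat.nthRoot k m) ^ k = m`
  (`exp_lt_size`: nontrivial exponents are `< size m`, i.e. `≤ lg m`), and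
  **`ppBase_eq_nthRoot`**: `ppBase m = Nat.nthRoot (ppExp m) m` for `m ≥ 1`.

## References

* H. Cohen, *A Course in Computational Algebraic Number Theory*, GTM 138, Springer 1993, §1.7
  (Integer roots, Algorithm 1.7.1; Power Detection: "to test whether `n = m^k` … this needs to
  be tried only for `k ≤ lg n`"; held, `book:cohen1993-course-computational-algebraic-number-theory`
  p. 84 of the file = printed pp. 38–39). The digit-by-digit root `rootScan` is the elementary
  binary search, not Cohen's Newton iteration.
* P. W. Shor, SIAM J. Comput. 26 (1997), §5 p.16 (prime powers are handled classically).
-/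

namespace Literature.Computability.Cryptography

namespace Shor1997

/-! ### Two more facts on `Nat.nthRoot` -/

/-- The integer root is antitone in the exponent: `1 ≤ k ≤ k'` gives
`Nat.nthRoot k' m ≤ Nat.nthRoot k m`. [folklore] -/
theorem nthRoot_anti {m k k' : ℕ} (hk : 0 < k) (hkk : k ≤ k') : Nat.nthRoot k' m ≤ Nat.nthRoot k m := by
  have hk' : k' ≠ 0 := by omega
  rw [Nat.le_nthRoot_iff hk.ne']
  rcases Nat.eq_zero_or_pos (Nat.nthRoot k' m) with h0 | hpos
  · rw [h0, zero_pow hk.ne']; exact Nat.zero_le _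
  · exact (Nat.pow_le_pow_right hpos hkk).trans (Nat.pow_nthRoot_le (Or.inl hk'))

/-- Bits needed: `Nat.nthRoot k m ≤ m < 2 ^ size m` (`k ≥ 1`). [folklore] -/
theorem nthRoot_lt_two_pow_size {m k : ℕ} (hk : 0 < k) : Nat.nthRoot k m < 2 ^ m.size := by
  have h : Nat.nthRoot k m ≤ m := by
    rw [← Nat.lt_succ_iff, Nat.nthRoot_lt_iff hk.ne']
    exact (Nat.lt_succ_self m).trans_le (Nat.le_self_pow hk.ne' _)
  exact h.trans_lt (Nat.lt_size_self m)

/-! ### The root digit by digit -/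

/-- The digit-by-digit root: bits `J, …, 0` are decided greedily (set bit `j` if the `k`-th
power of the candidate still fits under `m`). [folklore] -/
def rootScan (m k : ℕ) : ℕ → ℕ → ℕ
  | 0, b => if (b + 1) ^ k ≤ m then b + 1 else b
  | J + 1, b => rootScan m k J (if (b + 2 ^ (J + 1)) ^ k ≤ m then b + 2 ^ (J + 1) else b)

/-- Invariant of the scan: started from `b` with `b ^ k ≤ m < (b + 2 ^ (J+1)) ^ k`, it returns
an `a` with `a ^ k ≤ m < (a + 1) ^ k`. [folklore] -/
theorem rootScan_spec {m k : ℕ} : ∀ (J b : ℕ), b ^ k ≤ m → m < (b + 2 ^ (J + 1)) ^ k →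
    (rootScan m k J b) ^ k ≤ m ∧ m < (rootScan m k J b + 1) ^ k
  | 0, b, h1, h2 => by
    simp only [rootScan, pow_one, zero_add] at h2 ⊢
    by_cases h : (b + 1) ^ k ≤ m
    · rw [if_pos h]; exact ⟨h, by simpa using h2⟩
    · rw [if_neg h]; exact ⟨h1, not_le.1 h⟩
  | J + 1, b, h1, h2 => by
    simp only [rootScan]
    by_cases h : (b + 2 ^ (J + 1)) ^ k ≤ m
    · rw [if_pos h]
      refine rootScan_spec J _ h ?_
      rw [add_assoc, ← two_mul, ← pow_succ']; exact h2
    · rw [if_neg h]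
      exact rootScan_spec J b h1 (not_le.1 h)

/-- **The scan computes the integer root** whenever `J + 1` bits suffice:
`Nat.nthRoot k m < 2 ^ (J + 1)` (`k ≥ 1`). [folklore] -/
theorem rootScan_eq_nthRoot {m k J : ℕ} (hk : 0 < k) (hJ : Nat.nthRoot k m < 2 ^ (J + 1)) :
    rootScan m k J 0 = Nat.nthRoot k m := by
  have h0 : (0 : ℕ) ^ k ≤ m := by simp [zero_pow hk.ne']
  have h2 : m < (0 + 2 ^ (J + 1)) ^ k := by
    rw [zero_add, ← Nat.nthRoot_lt_iff hk.ne']; exact hJ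
  obtain ⟨a, b⟩ := rootScan_spec J 0 h0 h2
  exact (Nat.nthRoot_eq_of_le_of_lt a b).symm

/-! ### The perfect-power base by roots -/

/-- The largest exponent `k ≤ size m`, `k ≥ 1`, for which `m` is a perfect `k`-th power
(`1` always qualifies when `m ≥ 1`; exponents of nontrivial powers are `< size m`, i.e.
`≤ lg m`, `exp_lt_size`). [cite: Cohen1993, §1.7 (power detection: k-th roots for k ≤ lg n)] -/
def ppExp (m : ℕ) : ℕ := Nat.findGreatest (fun k => 0 < k ∧ Nat.nthRoot k m ^ k = m) m.size

/-- `ppExp m ≤ size m`. [folklore] -/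
theorem ppExp_le_size (m : ℕ) : ppExp m ≤ m.size := Nat.findGreatest_le _

/-- For `m ≥ 1`, `ppExp m` is a valid exponent. [folklore] -/
theorem ppExp_spec {m : ℕ} (hm : 0 < m) : 0 < ppExp m ∧ Nat.nthRoot (ppExp m) m ^ ppExp m = m := by
  have h1 : (0 < 1 ∧ Nat.nthRoot 1 m ^ 1 = m) := ⟨Nat.one_pos, by simp⟩
  exact Nat.findGreatest_spec (P := fun k => 0 < k ∧ Nat.nthRoot k m ^ k = m) (Nat.size_pos.2 hm) h1

/-- Exponents of perfect-power representations with base `≥ 2` are `< size m` (Cohen: `k ≤ lg n`;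
`size m = lg m + 1`). [cite: Cohen1993, §1.7 (k ≤ lg n)] -/
theorem exp_lt_size {m b k : ℕ} (hb : 2 ≤ b) (h : b ^ k = m) : k < m.size := by
  have h2k : 2 ^ k ≤ m := by rw [← h]; exact Nat.pow_le_pow_left hb k
  exact Nat.lt_size.2 h2k

/-- Maximality of `ppExp`: any valid exponent `k ≤ size m` is at most `ppExp m`. [folklore] -/
theorem le_ppExp {m k : ℕ} (hk : 0 < k) (hks : k ≤ m.size) (h : Nat.nthRoot k m ^ k = m) : k ≤ ppExp m :=
  Nat.le_findGreatest (P := fun k => 0 < k ∧ Nat.nthRoot k m ^ k = m) hks ⟨hk, h⟩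

/-- **The perfect-power base is an integer root**: `ppBase m = Nat.nthRoot (ppExp m) m` for
`m ≥ 1` (the least base belongs to the largest exponent). The hypothesis is needed only at
`m = 0`, where `ppExp 0 = 0` and Mathlib's convention `Nat.nthRoot 0 0 = 1 ≠ 0 = ppBase 0`
breaks the identity. [cite: Cohen1993, §1.7 (power detection: k-th roots for k ≤ lg n)] -/
theorem ppBase_eq_nthRoot {m : ℕ} (hm : 0 < m) : ppBase m = Nat.nthRoot (ppExp m) m := by
  obtain ⟨hk0, hpow⟩ := ppExp_spec hm
  set k₀ := ppExp m with hk₀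
  set r := Nat.nthRoot k₀ m with hr
  obtain ⟨k', hk', hb⟩ := ppBase_spec m
  set b₀ := ppBase m with hb₀
  rcases Nat.lt_or_ge 1 m with hm1 | hm1
  · have hb1 : 1 < b₀ := one_lt_ppBase hm1
    have hr1 : 1 < r := by
      by_contra hle; push Not at hle
      interval_cases hrr : r
      · rw [zero_pow hk0.ne'] at hpow; omega
      · rw [one_pow] at hpow; omega
    -- minimality of the base and maximality of the exponent
    have hle : b₀ ≤ r := ppBase_le_of_pow_eq hr1 hk0 hpow
    have hk's : k' ≤ m.size := (exp_lt_size hb1 hb).le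
    have hrk' : Nat.nthRoot k' m = b₀ := by rw [← hb]; exact Nat.nthRoot_pow hk'.ne' _
    have hk'le : k' ≤ k₀ := le_ppExp hk' hk's (by rw [hrk', hb])
    rcases hle.lt_or_eq with hlt | heq
    · exfalso
      -- b₀ < r and k' ≤ k₀ give b₀ ^ k' < r ^ k' ≤ r ^ k₀ = m = b₀ ^ k'
      have h1 : b₀ ^ k' < r ^ k' := Nat.pow_lt_pow_left hlt hk'.ne'
      have h2 : r ^ k' ≤ r ^ k₀ := Nat.pow_le_pow_right (by omega) hk'le
      omega
    · exact heq
  · -- m = 1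
    obtain rfl : m = 1 := le_antisymm hm1 hm
    have h1 : b₀ = 1 := by
      rw [pow_eq_one_iff] at hb
      exact hb.resolve_right hk'.ne'
    rw [h1, hr, Nat.nthRoot_one_right]

end Shor1997

end Literature.Computability.Cryptography
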